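import Literature.NumberTheory.EllipticCurves.CastellaHsieh2018.BranchBDPLFunctionValueAtConductorP
import HarnessLib

/-!
# Castella–Hsieh 2018, Lemma 5.4 + Thm. 5.7 — the SIGNED form of the branch value fact: the branch
# constant is a SIGN, `e = ε(½, χ_{ε,𝔭})⁻² = χ_{ε,𝔭}(−1) ∈ {1, −1}`

F. Castella, M.-L. Hsieh, *Heegner cycles and p-adic L-functions*, Math. Ann. **370** (2018) 567–628 =
arXiv:1505.08165v1 (held `paper:arxiv-1505.08165`). Companion of `BranchBDPLFunctionValueAtConductorP.lean`
(the named fact `castellaHsieh2018_branchValue_conductorP`, "V"): the SAME printed theorem read with the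
branch constant PINNED to a sign. Filed separately, V's audited bytes untouched (ARM-P ruling
PIN-SEPARATE, `pub/bsd-stepL/INBOX.md` 2026-08-27T10:35:46Z (3); request of cell `bsd-schneider-ideate`
door-c3 gen 11, predicate `KYRead.CHFrameValueVH` = V's clause with `e = ±1`). ONE named fact + two proved
theorems; no `sorry`, no instance, no notation.

## Why the constant is a sign (what is printed; held `paper:arxiv-1505.08165`, v1 TeX pages `pNNNN:Lnn`)

* [CastellaHsieh2018] §3.3, the multiplier of the interpolation formula (p0010:L16–L20, display before
  Prop. 3.4 [journal: before Prop. 3.6]): "define the multiplier `e_𝔭(f,χ)` by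
  `e_𝔭(f,χ) = (1 − 𝐚_p(f)p^{−r}χ_𝔭̄(p) + χ_𝔭̄(p²)p^{−1})²`
  if `p ∤ c`, **`ε(½, χ_𝔭)^{−2}` if `p ∣ c`**" (`c𝒪_K` the conductor of `χ`); Prop. 3.4 (p0010:L22–L30,
  "`u_K = #(𝒪_K^×)/2` and `ε(f) := ∏_q ε(½, π_q)` is the global root number of `f`"); Prop. 3.6
  [journal 3.8] (p0011:L7–L10): "`(ℒ_{𝔭,ψ}(f)(φ̂)/Ω_p^{2r+2m})² = L^{alg}(½, π_K ⊗ ψφ) · e_𝔭(f, ψφ) ·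
  φ(𝔑^{−1}) · 2^{#A(ψ)+3} c_o ε(f) · u_K² √D_K`", with (p0010:L14) "`L^{alg}(½, π_K ⊗ χ) =
  Γ(2r+m)Γ(m+1)/((4π)^{2r+2m+1}(Im ϑ)^{2r+2m}) · L(½, π_K ⊗ χ)/Ω_K^{4(r+m)}`"; the local constant is
  Tate's (p0004:L51–L55: "`𝔤(φ) = Σ_{u ∈ (ℤ/qⁿℤ)^×} φ(u) ζ_{pⁿ}^u` … `ε(s, π) := ε(s, π, ψ_q)` the local
  `ε`-factor … if `χ` is a character of conductor `qⁿ`, then `ε(s, χ) = 𝔤(χ^{−1})·χ(−qⁿ)q^{−ns}`,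
  `ε(s, χ)ε(1−s, χ^{−1}) = χ(−1)`" — the two formulas used are p0004:L54–L55), and for a character of
  conductor `pⁿ` (p0019:L33) "`ε(φ̂_𝔭) = ε(0, φ_𝔭) = 𝔤(φ_𝔭^{−1}) φ_𝔭(−pⁿ)`".
* [Bump1997] §1.1 (1.5) (p. 13) "`|τ(χ)| = √N`" and Exercise 1.1.1 (p. 17) "`τ(χ̄) = χ(−1)·conj(τ(χ))`"
  (used in the text between (1.6) and (1.7), p. 14): for a REAL primitive `χ` mod `p`,
  `𝔤(χ)² = τ(χ)² = χ(−1)·p`.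
* [TateNTB1979] (3.2.3)/(3.4.6): for `μ` unramified `ε(s, χμ, ψ) = μ(ϖ)^{a(χ)+n(ψ)} ε(s, χ, ψ)` (the
  unramified-twist rule, as in the predicate file `BDPBranchPAdicLFunction`); §3.4: `ε(s, χ, ψ) =
  ε(0, χ, ψ)·(pⁿ)^{−s}` for `χ` of conductor `pⁿ` (`n(ψ) = 0`).
* READING in the tree's currency (`IsBranchBDPLFunction ι 𝔭 κ γ f χ e Ω_K Ω_p L`, file
  `BDPBranchPAdicLFunction`: the value at `φ̂(γ) − 1` is `ι⁻¹(Γ(n)Γ(n+1)·e·φ(𝔭)^{−2}·L(f/K, χφ, 1)/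
  (π^{2n+1}Ω_K^{4n}))·Ω_p^{4n}`, `e` "MEANT `ε(½, χ_𝔭)^{−2}`" — its module docstring). On the `χ_ε`-branch
  the characters `χ_ε φ` (`φ` unramified of infinity type `(n,−n)`, `n = r + m = 1 + m`) have conductor
  `p` (`a(χ_{ε,𝔭}) = 1`), so `e_𝔭(f, χ_ε φ) = ε(½, χ_{ε,𝔭}φ_𝔭)^{−2} = ε(½, χ_{ε,𝔭})^{−2} · φ_𝔭(p)^{−2}`
  by the unramified-twist rule, and `χ_{ε,𝔭} = ε_{p*,p}` is QUADRATIC of conductor `p`, so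
  `ε(½, χ_{ε,𝔭})² = ε(0, χ_{ε,𝔭})²·p^{−1} = 𝔤(χ_{ε,𝔭})² χ_{ε,𝔭}(−p)²·p^{−1} = χ_{ε,𝔭}(−1) = (−1)^{(p−1)/2}`:
  the branch constant is the SIGN `e = χ_{ε,𝔭}(−1) ∈ {1, −1}`. The remaining `n`-INDEPENDENT constants
  of Prop. 3.6 — `2^{#A(ψ)+3} c_o ε(f) u_K² √D_K` with `A(ψ) = ∅` under (Heeg), `c_o = 1`, `ε(f) = ±1`,
  `u_K = 1` (`d_K ∉ {−3,−4}`), `√D_K ∈ 𝒲^×` (`p ∤ D_K`; `ℚ_p(√D_K)/ℚ_p` is unramified), the sign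
  `χ_ε(𝔑^{−1})`, and the `4` of `(4π)^{2n+1} = 4·16^n·π^{2n+1}` — form, for `p` odd and split in `K` of odd
  discriminant `d_K ≠ −3`, a UNIT `A` of `R₀ = 𝒲` (V's module docstring, "The frame and its constants"),
  `φ̂(σ_𝔑)` is the unit power series `(1+T)^{s_𝔑}` at `T_φ`, and the `n`-dependent `16^n (Im ϑ)^{2n}`
  are absorbed in `Ω_K^{4n}` (`Ω_K ↦ 2(Im ϑ)^{1/2}Ω_K`); replacing `L` by `A^{−1}·L ∈ R₀⟦T⟧` and the
  unit `u` of the value clause by `A^{−1}u ∈ R₀^×` leaves every clause of V intact and makes the constant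
  EXACTLY a sign. (So V's frame CAN be chosen with `e = ±1`; V itself records only `e ≠ 0`, from
  which the sign is NOT recoverable — a frame rescaled by `ι⁻¹(1/e)` need not lie in `R₀⟦T⟧` — hence a
  separately named fact rather than a corollary of V.) WHICH sign is a matter of what one keeps in `e`
  rather than in the unit `A`: `χ_{ε,𝔭}(−1) = (−1/p)` if the sign `χ_ε(𝔑^{−1}) = (N/p)` goes into `A`,
  `(−N/p)` if it is kept in `e` (director-bsd 2026-08-27T08:02:51Z: "a SIGN `e = (−N′/p)`"); only
  `e ∈ {1, −1}` is asserted below.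
* Why the pin matters although periods are "fresh" (recorded for the consumer, not asserted): two frames
  `L, L′` of the same `(f, χ_ε)` at `(ι, 𝔭, κ, γ)` with parameters `(e, Ω_K, Ω_p)`, `(e′, Ω_K′, Ω_p′)`
  satisfy `L′(T_φ) = ι⁻¹(e′/e)·λ^{4n}·L(T_φ)`, `λ := ι⁻¹(Ω_K/Ω_K′)·Ω_p′/Ω_p`, at the infinitely many
  interpolation points of each infinity type `(n,−n)`; by Weierstrass preparation `L′ = ι⁻¹(e′/e)λ^{4n}L`
  for every `n`, so `λ⁴ = 1` and `L′ = ι⁻¹(e′/e)·L`: frames differ by the CONSTANT `e′/e` only, and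
  `μ(L′) = μ(L)` as soon as both constants are signs (or units).

## Scope / what is NOT claimed

Which sign (`(−1/p)` or `(−N/p)` according to what is absorbed in the unit; only `e ∈ {1, −1}` is
asserted, the shape the consumer predicate `KYRead.CHFrameValueVH` carries); nothing about frames OTHER than the one exhibited (frames are
free up to a unit of `R₀` and a rescaling of the periods, so "every frame has `e = ±1`" is false);
everything else exactly as in V (same hypotheses, incl. `d_K ≠ −3`; same dictionary flags (d1)–(d4)).

* `castellaHsieh2018_branchValue_conductorP_signed` — the named fact (ONE `def … : Prop`).
* `castellaHsieh2018_branchValue_conductorP_of_signed` — it implies V (PROVED, forget the sign).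
* `castellaHsieh2018_branchValue_conductorP_signed.hasValueAt` — accessor with named binders (PROVED).
-/

noncomputable section

open scoped Classical

open NumberField IsDedekindDomain Field Literature.NumberTheory.EllipticCurves.ModularForms
open Literature.NumberTheory.GaloisRepresentations

namespace Literature.NumberTheory.EllipticCurves

section Fact

/-- **Castella–Hsieh 2018, Lemma 5.4 + Thm. 5.7 with the §3.3 multiplier made explicit — SIGNED form
("V⁺") of `castellaHsieh2018_branchValue_conductorP`.** Under exactly the hypotheses of that fact
(`W/ℚ` elliptic, globally minimal model, parametrisation datum `Dt` at level `N`, `p` odd, `p ∤ N`,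
`p ∤ φ(N)`, `f` ordinary at `p`, `K` imaginary quadratic of odd discriminant `d_K ≠ −3`, `p = 𝔭𝔭̄` split
with `𝔭` singled out by `ι`, (Heeg), orientation `β`, `κ` the anticyclotomic `ℤ_p`-extension with
topological generator `γ`): there are a branch SIGN `e ∈ {1, −1}` (Castella–Hsieh §3.3
"`e_𝔭(f,χ) = ε(½, χ_𝔭)^{−2}` if `p ∣ c`", and `ε(½,χ)² = 𝔤(χ)²/p = χ(−1)` for the quadratic `χ_{ε,𝔭}`
(CH18 p. 19 "`ε(0,φ_𝔭) = 𝔤(φ_𝔭^{−1})φ_𝔭(−pⁿ)`", Gauss sum of a real character); the remaining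
`n`-independent constants of Prop. 3.6 — a unit of `𝒲` and signs — absorbed into `L`, so only
`e ∈ {1,−1}` is asserted, not which sign), CM periods
`Ω_K ≠ 0`, `Ω_p ∈ R₀^×`, a frame `L ∈ R₀⟦T⟧` with `IsBranchBDPLFunction ι 𝔭 κ γ Dt.f χ_ε e Ω_K Ω_p L`,
AND a unit `u ∈ R₀^×` such that `L(0) = u · p^{−1} · (log_{ω_W}(j_* z)/c)²` for the genus-twisted
Heegner point `z = Σ_τ s(τ)·y^τ` of conductor `p` read through any embedding `j` above `𝔭` — V's value
clause verbatim. See the module docstring for the reading and its scope.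
[cite: CastellaHsieh2018, §3.3 (display before Prop. 3.4 [journal: before Prop. 3.6]) and Prop. 3.6 [journal: Prop. 3.8] (arXiv:1505.08165v1 pp. 10–11); Lemma 5.4, Thm. 5.7, Thm. 5.1, proof of Thm. 4.8 [journal: Thm. 4.9] (pp. 15–19)]
[cite: Bump1997, §1.1 (1.5) (p. 13) and Exercise 1.1.1 (p. 17): τ(χ)² = χ(−1)p for a real primitive χ mod p]
[cite: TateNTB1979, (3.2.3)/(3.4.6) (unramified twist) and §3.4 (s-dependence)]
[cite: Castella2018, Thm. 3.1 (arXiv:1704.06608 p. 9), the normalisation of the frame] -/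
def castellaHsieh2018_branchValue_conductorP_signed : Prop :=
  ∀ {p : ℕ} [Fact p.Prime] (ι : PadicAlgCl p ≃+* ℂ) (W : WeierstrassCurve ℚ) [W.IsElliptic]
    [W.IsGloballyMinimal] (K : Type) [Field K] [NumberField K] [IsGalois ℚ K] (ι₀ : K →+* ℂ)
    (𝔭 : HeightOneSpectrum (𝓞 K)) (κ : ZpExtension K p) (γ : absoluteGaloisGroup K) {N : ℕ}
    [NeZero N] (Dt : ModularParametrizationData W N) (β : ℤ),
    p ≠ 2 → ¬ p ∣ N → ¬ p ∣ Nat.totient N → ¬ (p : ℤ) ∣ W.LFunction p →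
    IsImaginaryQuadratic K → Odd (NumberField.discr K) → NumberField.discr K ≠ -3 →
    ((Ideal.span {(p : ℤ)}).primesOver (𝓞 K)).ncard = 2 →
    ((p : ℕ) : 𝓞 K) ∈ 𝔭.asIdeal →
    (∀ (w : InfinitePlace K) (k : 𝓞 K),
      k ∈ 𝔭.asIdeal ↔ ‖ι.symm (w.embedding (k : K))‖ < 1) →
    SatisfiesHeegnerHypothesis N K → (4 * (N : ℤ)) ∣ β ^ 2 - NumberField.discr K →
    κ.IsAnticyclotomic → κ.IsTopGenerator γ →
    ∃ (e : ℂ) (ΩK : ℂ) (Ωp : (unrIntegers p)ˣ) (L : UnrSeries p),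
      (e = 1 ∨ e = -1) ∧ ΩK ≠ 0 ∧
      IsBranchBDPLFunction ι 𝔭 κ γ Dt.f (genusHeckeCharacter K p) e ΩK
        ((Ωp : unrIntegers p) : ℂ_[p]) L ∧
      ∃ u : (unrIntegers p)ˣ,
        ∀ [NumberField (ringClassField K ι₀ p)]
          [(W.baseChange ℂ_[p]).IsIntegral (NormedField.valuation (K := ℂ_[p])).integer]
          (y : (W.baseChange (ringClassField K ι₀ p : Type)).toAffine.Point),
          WeierstrassCurve.Affine.Point.map (ringClassField K ι₀ p).subtype.toRatAlgHom y =
            heegnerPointComplexOfConductor Dt (NumberField.discr K) β p →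
          ∀ (θ : ringClassField K ι₀ p),
            θ ^ 2 = algebraMap ℚ (ringClassField K ι₀ p) ((-1 : ℚ) ^ (p / 2) * p) →
          ∀ (s : ringClassGal ι₀ p → ℤˣ),
            (∀ σ : ringClassGal ι₀ p, σ.1 θ = ((s σ : ℤ) : ringClassField K ι₀ p) * θ) →
          ∀ (j : ringClassField K ι₀ p →+* ℂ_[p]),
            (∀ k : 𝓞 K, k ∈ 𝔭.asIdeal ↔
              ‖j (algebraMap K (ringClassField K ι₀ p) (k : K))‖ < 1) →
            L.HasValueAt 0
              (((u : unrIntegers p) : ℂ_[p]) * ((p : ℂ_[p]))⁻¹ *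
                (FormalGroupChart.padicLogPointFiniteExt (NormedField.valuation (K := ℂ_[p]))
                    (W.baseChange ℂ_[p]) p
                    (WeierstrassCurve.Affine.Point.map j.toRatAlgHom
                      (∑ τ : ringClassGal ι₀ p,
                        (s τ : ℤ) • pointGalHom W (ringClassField K ι₀ p : Type) τ.1 y)) /
                  (Dt.c : ℂ_[p])) ^ 2)

end Fact

/-! ### API (proved) -/

section API

variable {p : ℕ} [Fact p.Prime]

/-- **The signed form implies V** = Castella–Hsieh's value formula as vendored in
`castellaHsieh2018_branchValue_conductorP` (forget that the constant is a sign: `±1 ≠ 0`).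
[cite: CastellaHsieh2018, Lemma 5.4 and Thm. 5.7 (arXiv:1505.08165v1 pp. 17, 19)] -/
theorem castellaHsieh2018_branchValue_conductorP_of_signed
    (h : castellaHsieh2018_branchValue_conductorP_signed) :
    castellaHsieh2018_branchValue_conductorP := by
  intro p _ ι W _ _ K _ _ _ ι₀ 𝔭 κ γ N _ Dt β hp2 hpN hφ hord hK hodd hdK hsplit h𝔭 hcompat hHeeg hβ hκ hγ
  obtain ⟨e, ΩK, Ωp, L, he, hΩ, hL, hu⟩ :=
    h ι W K ι₀ 𝔭 κ γ Dt β hp2 hpN hφ hord hK hodd hdK hsplit h𝔭 hcompat hHeeg hβ hκ hγ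
  exact ⟨e, ΩK, Ωp, L, by rcases he with rfl | rfl <;> norm_num, hΩ, hL, hu⟩

/-- **Accessor with named binders** for the signed form (same binder list and order as
`castellaHsieh2018_branchValue_conductorP.hasValueAt`; the conclusion carries `e = 1 ∨ e = -1`).
[cite: CastellaHsieh2018, §3.3 and Prop. 3.6 = journal Prop. 3.8; Lemma 5.4, Thm. 5.7] -/
theorem castellaHsieh2018_branchValue_conductorP_signed.hasValueAt
    (h : castellaHsieh2018_branchValue_conductorP_signed) (ι : PadicAlgCl p ≃+* ℂ)
    (W : WeierstrassCurve ℚ) [W.IsElliptic] [W.IsGloballyMinimal] (K : Type) [Field K]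
    [NumberField K] [IsGalois ℚ K] (ι₀ : K →+* ℂ) (𝔭 : HeightOneSpectrum (𝓞 K))
    (κ : ZpExtension K p) (γ : absoluteGaloisGroup K) {N : ℕ} [NeZero N]
    (Dt : ModularParametrizationData W N) (β : ℤ) (hp2 : p ≠ 2) (hpN : ¬ p ∣ N)
    (hφ : ¬ p ∣ Nat.totient N) (hord : ¬ (p : ℤ) ∣ W.LFunction p) (hK : IsImaginaryQuadratic K)
    (hodd : Odd (NumberField.discr K)) (hdK : NumberField.discr K ≠ -3)
    (hsplit : ((Ideal.span {(p : ℤ)}).primesOver (𝓞 K)).ncard = 2)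
    (h𝔭 : ((p : ℕ) : 𝓞 K) ∈ 𝔭.asIdeal)
    (hcompat : ∀ (w : InfinitePlace K) (k : 𝓞 K),
      k ∈ 𝔭.asIdeal ↔ ‖ι.symm (w.embedding (k : K))‖ < 1)
    (hHeeg : SatisfiesHeegnerHypothesis N K) (hβ : (4 * (N : ℤ)) ∣ β ^ 2 - NumberField.discr K)
    (hκ : κ.IsAnticyclotomic) (hγ : κ.IsTopGenerator γ) :
    ∃ (e : ℂ) (ΩK : ℂ) (Ωp : (unrIntegers p)ˣ) (L : UnrSeries p),
      (e = 1 ∨ e = -1) ∧ ΩK ≠ 0 ∧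
      IsBranchBDPLFunction ι 𝔭 κ γ Dt.f (genusHeckeCharacter K p) e ΩK
        ((Ωp : unrIntegers p) : ℂ_[p]) L ∧
      ∃ u : (unrIntegers p)ˣ,
        ∀ [NumberField (ringClassField K ι₀ p)]
          [(W.baseChange ℂ_[p]).IsIntegral (NormedField.valuation (K := ℂ_[p])).integer]
          (y : (W.baseChange (ringClassField K ι₀ p : Type)).toAffine.Point),
          WeierstrassCurve.Affine.Point.map (ringClassField K ι₀ p).subtype.toRatAlgHom y =
            heegnerPointComplexOfConductor Dt (NumberField.discr K) β p →
          ∀ (θ : ringClassField K ι₀ p),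
            θ ^ 2 = algebraMap ℚ (ringClassField K ι₀ p) ((-1 : ℚ) ^ (p / 2) * p) →
          ∀ (s : ringClassGal ι₀ p → ℤˣ),
            (∀ σ : ringClassGal ι₀ p, σ.1 θ = ((s σ : ℤ) : ringClassField K ι₀ p) * θ) →
          ∀ (j : ringClassField K ι₀ p →+* ℂ_[p]),
            (∀ k : 𝓞 K, k ∈ 𝔭.asIdeal ↔
              ‖j (algebraMap K (ringClassField K ι₀ p) (k : K))‖ < 1) →
            L.HasValueAt 0
              (((u : unrIntegers p) : ℂ_[p]) * ((p : ℂ_[p]))⁻¹ *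
                (FormalGroupChart.padicLogPointFiniteExt (NormedField.valuation (K := ℂ_[p]))
                    (W.baseChange ℂ_[p]) p
                    (WeierstrassCurve.Affine.Point.map j.toRatAlgHom
                      (∑ τ : ringClassGal ι₀ p,
                        (s τ : ℤ) • pointGalHom W (ringClassField K ι₀ p : Type) τ.1 y)) /
                  (Dt.c : ℂ_[p])) ^ 2) :=
  h ι W K ι₀ 𝔭 κ γ Dt β hp2 hpN hφ hord hK hodd hdK hsplit h𝔭 hcompat hHeeg hβ hκ hγ

end API

end Literature.NumberTheory.EllipticCurves

end
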